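/-
  HodgeLocusCensusUnitColumnRankDropThirdBoundary.lean — pub-hlocus ENGINE B (ivhs-2, gen 56), PROBE 21.
  certified instances and evidence bearing on the general Hodge conjecture; no claim.

  KERNEL RANK THEOREMS (evidence class; no census number changes; nothing about HC). THE THIRD BOUNDARY OF THE FIRST BAND.
  For a prime p > c ≥ 2, a field K of characteristic p, a field K₀ of characteristic 0 and anchor 229's multiplicity matrix of ×q^c on
  K[x₁,…,x_k]/(xᵢ^{e+2}) at level j (VERBATIM, as in anchors 230/294/296/298/304/307), in the notation of anchor 304's (DROP) and anchor 307's (BAND)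
  (labels μ : Fin k → Fin (e+1); s = #{μ ≠ 0}, t = (j + Σμ)/(e+1) − s, m = k − s, T = min (t, m − t − c); for k < 2p + c each label carries the
  single binomial [T + c ≥ p]·C(m, T + c − p), anchor 307 `rank_charP_add_sum_single_eq_rank_charZero`):
  (BDRY3) `rank_charP_add_eq_rank_charZero_third_boundary` — HEADLINE: for k + c = 2p + 2 (2 ≤ c < p),
      rank_K + [j = (e+1)(p − c) ∨ j = (e+1)(p − c + 2)] + k·[(e+1)(p − c) < j < (e+1)(p − c + 2)] + C(k,2)·(e − |j − (e+1)(p − c + 1)|) = rank_{K₀},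
      i.e. across the 2e + 3 levels (e+1)(p − c) ≤ j ≤ (e+1)(p − c + 2) the characteristic-p rank drops by
      1, k, k + C(k,2), k + 2C(k,2), …, k + e·C(k,2) (centre), …, k + C(k,2), k, 1 and nowhere else — the first boundary at which a binomial
      C(k,2) enters (the zero label gives the two ends and k at the centre, `single_zero_label`; the one-coordinate labels give k at each interior
      level, `single_eq_ite_of_card_eq_one` + (C1'); the two-coordinate labels (y+1)·δ_l + (a − y − 1)·δ_l′ with j + a = (e+1)(p − c + 2) give
      C(k,2)·#{pairs in [1,e]² with sum a} = C(k,2)·(e − |a − (e+1)|), `single_eq_ite_of_card_eq_two` + the count `card_filter_card_eq_two_and_sum_eq`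
      (induction on k, peeling the first coordinate with `Fin.consEquiv`); three or more non-zero coordinates give nothing, `single_eq_zero_of_three_le`).
  |x − y| is written (x − y) + (y − x) with truncated subtractions. Anchors 304 (BDRY: k + c = 2p, one level) and 307 (BDRY2: k + c = 2p + 1, one band
  1, k, …, k, 1) are the first two boundaries. 12 theorems, 0 defs; imports anchor 307 `…HodgeLocusCensusUnitColumnRankDropBand` by name (hence 304,
  296, 294, 293, 230, 229); nothing restated but anchor 229's matrix and anchor 307's single-binomial label correction (VERBATIM); no sorries, axioms,
  instances or notation.
-/
import Summits.HodgeConjecture.HodgeConjecture.Theorems.HodgeLocusCensusUnitColumnRankDropBand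

set_option linter.dupNamespace false
set_option autoImplicit false

namespace Summit.HodgeConjecture.HodgeConjecture.HodgeLocus.Census.UnitColumnRankDropThirdBoundary

open Summit.HodgeConjecture.HodgeConjecture.HodgeLocus.Census.ModelNonJumpC1All (colR)
open Summit.HodgeConjecture.HodgeConjecture.HodgeLocus.Census.UnitColumnRankDropBand (rank_charP_add_sum_single_eq_rank_charZero
  card_filter_card_eq_one_and_sum_eq)

/-! ## §1 COUNTING LABELS: one non-zero coordinate with a shifted sum, and two non-zero coordinates -/

/-- (N) the number of `y < e` with `y + 2 ≤ a ≤ y + 1 + e`, i.e. of the pairs `(y + 1, a − y − 1) ∈ [1, e]²`, is `e − |a − (e+1)|`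
(written with truncated subtractions; `0` for `a ≤ 1` and for `a ≥ 2e + 1`). -/
theorem card_range_filter_eq (e a : ℕ) :
    ((Finset.range e).filter (fun y => y + 1 + 1 ≤ a ∧ a ≤ y + 1 + e)).card = e - ((a - (e + 1)) + ((e + 1) - a)) := by
  rw [show (Finset.range e).filter (fun y => y + 1 + 1 ≤ a ∧ a ≤ y + 1 + e) = Finset.Ico (a - (e + 1)) (min e (a - 1)) from
    Finset.ext (fun y => by simp only [Finset.mem_filter, Finset.mem_range, Finset.mem_Ico, Nat.min_def]; split_ifs <;> omega),
    Nat.card_Ico, Nat.min_def]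
  split_ifs <;> omega

/-- (PEEL) summing over the labels `μ : Fin (k+1) → Fin (e+1)` = summing over the first coordinate `x` and the tail `ν : Fin k → Fin (e+1)`
(`μ = Fin.cons x ν`, `Fin.consEquiv`). -/
theorem sum_eq_sum_sum_cons (k e : ℕ) (g : (Fin (k + 1) → Fin (e + 1)) → ℕ) :
    (∑ μ : Fin (k + 1) → Fin (e + 1), g μ) = ∑ x : Fin (e + 1), ∑ ν : Fin k → Fin (e + 1), g (Fin.cons x ν : Fin (k + 1) → Fin (e + 1)) := by
  rw [← Fintype.sum_prod_type', ← (Fin.consEquiv (fun _ : Fin (k + 1) => Fin (e + 1))).sum_comp]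
  rfl

/-- (C1') anchor 307's one-coordinate count with a shifted sum: `#{ν : one non-zero coordinate, b + Σν = a} = k · [b + 1 ≤ a ≤ b + e]`. -/
theorem card_filter_card_eq_one_and_add_sum_eq (k e b a : ℕ) :
    (Finset.univ.filter (fun ν : Fin k → Fin (e + 1) =>
        (Finset.univ.filter (fun l => (ν l : ℕ) ≠ 0)).card = 1 ∧ b + (∑ i, (ν i : ℕ)) = a)).card =
      if b + 1 ≤ a ∧ a ≤ b + e then k else 0 := by
  by_cases hb : b ≤ a
  · have h := card_filter_card_eq_one_and_sum_eq k e (a - b)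
    rw [Finset.filter_congr (fun ν _ => show (Finset.univ.filter (fun l => (ν l : ℕ) ≠ 0)).card = 1 ∧ (∑ i, (ν i : ℕ)) = a - b ↔
        (Finset.univ.filter (fun l => (ν l : ℕ) ≠ 0)).card = 1 ∧ b + ∑ i, (ν i : ℕ) = a by omega)] at h
    rw [h]
    by_cases h1 : b + 1 ≤ a ∧ a ≤ b + e
    · rw [if_pos h1, if_pos (by omega)]
    · rw [if_neg h1, if_neg (by omega)]
  · rw [if_neg (by omega), Finset.card_eq_zero]
    exact Finset.filter_eq_empty_iff.mpr (fun ν _ h => absurd h.2 (by omega))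

/-- (C2) COUNTING THE TWO-COORDINATE LABELS: `#{μ : Fin k → Fin (e+1) : two non-zero coordinates, Σμ = a} = C(k,2) · (e − |a − (e+1)|)`
(`μ = (y+1)·δ_l + (a − y − 1)·δ_{l′}`, `l < l′`; induction on `k` by (PEEL): the first coordinate is `0` (induction) or `y + 1` ((C1') for the tail),
`C(k+1, 2) = C(k, 2) + k`). -/
theorem card_filter_card_eq_two_and_sum_eq (k e a : ℕ) :
    (Finset.univ.filter (fun μ : Fin k → Fin (e + 1) =>
        (Finset.univ.filter (fun l => (μ l : ℕ) ≠ 0)).card = 2 ∧ (∑ i, (μ i : ℕ)) = a)).card =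
      k.choose 2 * (e - ((a - (e + 1)) + ((e + 1) - a))) := by
  induction k with
  | zero =>
    rw [Nat.choose_zero_succ, zero_mul, Finset.card_eq_zero, Finset.filter_eq_empty_iff]
    rintro μ - ⟨h2, -⟩
    rw [Finset.univ_eq_empty, Finset.filter_empty, Finset.card_empty] at h2
    exact absurd h2 (by decide)
  | succ k ih =>
    have hsum : ∀ (x : Fin (e + 1)) (ν : Fin k → Fin (e + 1)),
        (∑ i, ((Fin.cons x ν : Fin (k + 1) → Fin (e + 1)) i : ℕ)) = (x : ℕ) + ∑ i, (ν i : ℕ) := fun x ν => by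
      rw [Fin.sum_univ_succ]; rfl
    have hcard : ∀ (x : Fin (e + 1)) (ν : Fin k → Fin (e + 1)),
        (Finset.univ.filter (fun l => ((Fin.cons x ν : Fin (k + 1) → Fin (e + 1)) l : ℕ) ≠ 0)).card =
          (if (x : ℕ) ≠ 0 then 1 else 0) + (Finset.univ.filter (fun l => (ν l : ℕ) ≠ 0)).card := fun x ν => by
      rw [Finset.card_filter, Finset.card_filter, Fin.sum_univ_succ]; rfl
    rw [Finset.card_filter, sum_eq_sum_sum_cons]
    simp only [hsum, hcard]
    rw [Fin.sum_univ_succ]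
    simp only [Fin.val_zero, ne_eq, not_true_eq_false, if_false, zero_add, Fin.val_succ, Nat.add_one_ne_zero, not_false_eq_true, if_true,
      show ∀ n : ℕ, (1 + n = 2) ↔ (n = 1) from fun n => by omega]
    rw [← Finset.card_filter, ih]
    rw [Finset.sum_congr rfl (fun (y : Fin e) _ => by rw [← Finset.card_filter, card_filter_card_eq_one_and_add_sum_eq])]
    rw [Fin.sum_univ_eq_sum_range (fun n : ℕ => if n + 1 + 1 ≤ a ∧ a ≤ n + 1 + e then k else 0) e, ← Finset.sum_filter, Finset.sum_const,
      smul_eq_mul, card_range_filter_eq, Nat.choose_succ_succ k 1, Nat.choose_one_right]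
    ring

/-! ## §2 THE LABEL CORRECTION AT THE THIRD BOUNDARY `k + c = 2p + 2` (`c < p`; anchor 307's single binomial `[T + c ≥ p] · C(m, T + c − p)`) -/

/-- (T3) for `k + c ≤ 2p + 2` a label with at least THREE non-zero coordinates gives nothing: `2T + c ≤ m ≤ k − 3` forces `T + c < p`. -/
theorem single_eq_zero_of_three_le (p k e c j : ℕ) (hk : k + c ≤ 2 * p + 2) (μ : Fin k → Fin (e + 1))
    (h3 : 3 ≤ (Finset.univ.filter (fun l => (μ l : ℕ) ≠ 0)).card) :
    (if (e + 1) ∣ (j + ∑ i, (μ i : ℕ)) ∧ (e + 1) * (Finset.univ.filter (fun l => (μ l : ℕ) ≠ 0)).card ≤ j + ∑ i, (μ i : ℕ) then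
      (if k - (Finset.univ.filter (fun l => (μ l : ℕ) ≠ 0)).card < ((j + ∑ i, (μ i : ℕ)) / (e + 1) - (Finset.univ.filter (fun l => (μ l : ℕ) ≠ 0)).card) + c then 0
       else if min ((j + ∑ i, (μ i : ℕ)) / (e + 1) - (Finset.univ.filter (fun l => (μ l : ℕ) ≠ 0)).card)
           (k - (Finset.univ.filter (fun l => (μ l : ℕ) ≠ 0)).card -
             ((j + ∑ i, (μ i : ℕ)) / (e + 1) - (Finset.univ.filter (fun l => (μ l : ℕ) ≠ 0)).card) - c) + c < p then 0
       else (k - (Finset.univ.filter (fun l => (μ l : ℕ) ≠ 0)).card).choose (min ((j + ∑ i, (μ i : ℕ)) / (e + 1) - (Finset.univ.filter (fun l => (μ l : ℕ) ≠ 0)).card)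
           (k - (Finset.univ.filter (fun l => (μ l : ℕ) ≠ 0)).card -
             ((j + ∑ i, (μ i : ℕ)) / (e + 1) - (Finset.univ.filter (fun l => (μ l : ℕ) ≠ 0)).card) - c) + c - p))
     else 0) = 0 := by
  have hs : (Finset.univ.filter (fun l => (μ l : ℕ) ≠ 0)).card ≤ k :=
    (Finset.card_filter_le _ _).trans_eq (by rw [Finset.card_univ, Fintype.card_fin])
  split_ifs with hF hlt hb
  · rfl
  · rfl
  · exfalso
    revert hb
    rw [imp_false, not_not, Nat.min_def]
    split_ifs <;> omega
  · rfl

/-- (T2) for `c < p`, `k + c = 2p + 2` a label with exactly TWO non-zero coordinates (`m = k − 2 = 2p − c`) carries the correction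
`[j + Σμ = (e+1)(p − c + 2)]` (`T + c ≥ p` iff `T = p − c` iff `t = p − c`, binomial `C(m, 0) = 1`). -/
theorem single_eq_ite_of_card_eq_two (p k e c j : ℕ) (hcp : c < p) (hk : k + c = 2 * p + 2) (μ : Fin k → Fin (e + 1))
    (h2 : (Finset.univ.filter (fun l => (μ l : ℕ) ≠ 0)).card = 2) :
    (if (e + 1) ∣ (j + ∑ i, (μ i : ℕ)) ∧ (e + 1) * (Finset.univ.filter (fun l => (μ l : ℕ) ≠ 0)).card ≤ j + ∑ i, (μ i : ℕ) then
      (if k - (Finset.univ.filter (fun l => (μ l : ℕ) ≠ 0)).card < ((j + ∑ i, (μ i : ℕ)) / (e + 1) - (Finset.univ.filter (fun l => (μ l : ℕ) ≠ 0)).card) + c then 0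
       else if min ((j + ∑ i, (μ i : ℕ)) / (e + 1) - (Finset.univ.filter (fun l => (μ l : ℕ) ≠ 0)).card)
           (k - (Finset.univ.filter (fun l => (μ l : ℕ) ≠ 0)).card -
             ((j + ∑ i, (μ i : ℕ)) / (e + 1) - (Finset.univ.filter (fun l => (μ l : ℕ) ≠ 0)).card) - c) + c < p then 0
       else (k - (Finset.univ.filter (fun l => (μ l : ℕ) ≠ 0)).card).choose (min ((j + ∑ i, (μ i : ℕ)) / (e + 1) - (Finset.univ.filter (fun l => (μ l : ℕ) ≠ 0)).card)
           (k - (Finset.univ.filter (fun l => (μ l : ℕ) ≠ 0)).card -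
             ((j + ∑ i, (μ i : ℕ)) / (e + 1) - (Finset.univ.filter (fun l => (μ l : ℕ) ≠ 0)).card) - c) + c - p))
     else 0) =
    if j + ∑ i, (μ i : ℕ) = (e + 1) * (p - c + 2) then 1 else 0 := by
  rw [h2]
  by_cases hN : j + ∑ i, (μ i : ℕ) = (e + 1) * (p - c + 2)
  · rw [if_pos hN, hN, if_pos ⟨Dvd.intro _ rfl, Nat.mul_le_mul_left (e + 1) (show 2 ≤ p - c + 2 by omega)⟩, Nat.mul_div_cancel_left _ (Nat.succ_pos e),
      if_neg (by omega), show min (p - c + 2 - 2) (k - 2 - (p - c + 2 - 2) - c) = p - c by rw [Nat.min_def]; split_ifs <;> omega, if_neg (by omega),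
      Nat.sub_add_cancel hcp.le, Nat.sub_self, Nat.choose_zero_right]
  · rw [if_neg hN]
    split_ifs with hF hlt hb
    · rfl
    · rfl
    · exfalso
      obtain ⟨⟨q, hq⟩, -⟩ := hF
      rw [hq] at hN hlt hb
      rw [Nat.mul_div_cancel_left q (Nat.succ_pos e)] at hlt hb
      have hq' : q ≠ p - c + 2 := fun h => hN (by rw [h])
      revert hb
      rw [imp_false, not_not, Nat.min_def]
      split_ifs <;> omega
    · rfl

/-- (T1) for `c < p`, `k + c = 2p + 2` a label with exactly ONE non-zero coordinate (`m = k − 1 = 2p + 1 − c`) carries the correction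
`[j + Σμ = (e+1)(p − c + 1) ∨ j + Σμ = (e+1)(p − c + 2)]` (`T = p − c` iff `t ∈ {p − c, p − c + 1}`, binomial `C(m, 0) = 1`). -/
theorem single_eq_ite_of_card_eq_one (p k e c j : ℕ) (hcp : c < p) (hk : k + c = 2 * p + 2) (μ : Fin k → Fin (e + 1))
    (h1 : (Finset.univ.filter (fun l => (μ l : ℕ) ≠ 0)).card = 1) :
    (if (e + 1) ∣ (j + ∑ i, (μ i : ℕ)) ∧ (e + 1) * (Finset.univ.filter (fun l => (μ l : ℕ) ≠ 0)).card ≤ j + ∑ i, (μ i : ℕ) then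
      (if k - (Finset.univ.filter (fun l => (μ l : ℕ) ≠ 0)).card < ((j + ∑ i, (μ i : ℕ)) / (e + 1) - (Finset.univ.filter (fun l => (μ l : ℕ) ≠ 0)).card) + c then 0
       else if min ((j + ∑ i, (μ i : ℕ)) / (e + 1) - (Finset.univ.filter (fun l => (μ l : ℕ) ≠ 0)).card)
           (k - (Finset.univ.filter (fun l => (μ l : ℕ) ≠ 0)).card -
             ((j + ∑ i, (μ i : ℕ)) / (e + 1) - (Finset.univ.filter (fun l => (μ l : ℕ) ≠ 0)).card) - c) + c < p then 0
       else (k - (Finset.univ.filter (fun l => (μ l : ℕ) ≠ 0)).card).choose (min ((j + ∑ i, (μ i : ℕ)) / (e + 1) - (Finset.univ.filter (fun l => (μ l : ℕ) ≠ 0)).card)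
           (k - (Finset.univ.filter (fun l => (μ l : ℕ) ≠ 0)).card -
             ((j + ∑ i, (μ i : ℕ)) / (e + 1) - (Finset.univ.filter (fun l => (μ l : ℕ) ≠ 0)).card) - c) + c - p))
     else 0) =
    if j + ∑ i, (μ i : ℕ) = (e + 1) * (p - c + 1) ∨ j + ∑ i, (μ i : ℕ) = (e + 1) * (p - c + 2) then 1 else 0 := by
  rw [h1]
  by_cases hN : j + ∑ i, (μ i : ℕ) = (e + 1) * (p - c + 1) ∨ j + ∑ i, (μ i : ℕ) = (e + 1) * (p - c + 2)
  · rw [if_pos hN]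
    rcases hN with hN | hN
    · rw [hN, if_pos ⟨Dvd.intro _ rfl, Nat.mul_le_mul_left (e + 1) (show 1 ≤ p - c + 1 by omega)⟩, Nat.mul_div_cancel_left _ (Nat.succ_pos e),
        if_neg (by omega), show min (p - c + 1 - 1) (k - 1 - (p - c + 1 - 1) - c) = p - c by rw [Nat.min_def]; split_ifs <;> omega, if_neg (by omega),
        Nat.sub_add_cancel hcp.le, Nat.sub_self, Nat.choose_zero_right]
    · rw [hN, if_pos ⟨Dvd.intro _ rfl, Nat.mul_le_mul_left (e + 1) (show 1 ≤ p - c + 2 by omega)⟩, Nat.mul_div_cancel_left _ (Nat.succ_pos e),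
        if_neg (by omega), show min (p - c + 2 - 1) (k - 1 - (p - c + 2 - 1) - c) = p - c by rw [Nat.min_def]; split_ifs <;> omega, if_neg (by omega),
        Nat.sub_add_cancel hcp.le, Nat.sub_self, Nat.choose_zero_right]
  · rw [if_neg hN]
    split_ifs with hF hlt hb
    · rfl
    · rfl
    · exfalso
      obtain ⟨⟨q, hq⟩, -⟩ := hF
      rw [hq] at hN hlt hb
      rw [Nat.mul_div_cancel_left q (Nat.succ_pos e)] at hlt hb
      have hq' : q ≠ p - c + 1 := fun h => hN (Or.inl (by rw [h]))
      have hq'' : q ≠ p - c + 2 := fun h => hN (Or.inr (by rw [h]))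
      revert hb
      rw [imp_false, not_not, Nat.min_def]
      split_ifs <;> omega
    · rfl

/-- (T0) for `c < p`, `k + c = 2p + 2` the ZERO label (`m = k = 2p + 2 − c`) carries the correction
`[j = (e+1)(p − c) ∨ j = (e+1)(p − c + 2)] + k · [j = (e+1)(p − c + 1)]` (`T = p − c` at `t ∈ {p − c, p − c + 2}`: `C(k, 0) = 1`;
`T = p − c + 1` at the centre `t = p − c + 1 = k − t − c`: `C(k, 1) = k`). -/
theorem single_zero_label (p k e c j : ℕ) (hcp : c < p) (hk : k + c = 2 * p + 2) :
    (fun (μ : Fin k → Fin (e + 1)) =>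
      (if (e + 1) ∣ (j + ∑ i, (μ i : ℕ)) ∧ (e + 1) * (Finset.univ.filter (fun l => (μ l : ℕ) ≠ 0)).card ≤ j + ∑ i, (μ i : ℕ) then
        (if k - (Finset.univ.filter (fun l => (μ l : ℕ) ≠ 0)).card < ((j + ∑ i, (μ i : ℕ)) / (e + 1) - (Finset.univ.filter (fun l => (μ l : ℕ) ≠ 0)).card) + c then 0
         else if min ((j + ∑ i, (μ i : ℕ)) / (e + 1) - (Finset.univ.filter (fun l => (μ l : ℕ) ≠ 0)).card)
             (k - (Finset.univ.filter (fun l => (μ l : ℕ) ≠ 0)).card -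
               ((j + ∑ i, (μ i : ℕ)) / (e + 1) - (Finset.univ.filter (fun l => (μ l : ℕ) ≠ 0)).card) - c) + c < p then 0
         else (k - (Finset.univ.filter (fun l => (μ l : ℕ) ≠ 0)).card).choose (min ((j + ∑ i, (μ i : ℕ)) / (e + 1) - (Finset.univ.filter (fun l => (μ l : ℕ) ≠ 0)).card)
             (k - (Finset.univ.filter (fun l => (μ l : ℕ) ≠ 0)).card -
               ((j + ∑ i, (μ i : ℕ)) / (e + 1) - (Finset.univ.filter (fun l => (μ l : ℕ) ≠ 0)).card) - c) + c - p))
       else 0)) (fun _ => 0) =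
    (if j = (e + 1) * (p - c) ∨ j = (e + 1) * (p - c + 2) then 1 else 0) + (if j = (e + 1) * (p - c + 1) then k else 0) := by
  have hs : (Finset.univ.filter (fun l : Fin k => (((fun _ => (0 : Fin (e + 1))) l : Fin (e + 1)) : ℕ) ≠ 0)).card = 0 := by
    simp
  have hsum : (∑ i : Fin k, (((fun _ => (0 : Fin (e + 1))) i : Fin (e + 1)) : ℕ)) = 0 := by simp
  simp only [hs, hsum, add_zero, mul_zero, Nat.sub_zero]
  by_cases hd : (e + 1) ∣ j
  · obtain ⟨t, rfl⟩ := hd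
    rw [if_pos ⟨Dvd.intro _ rfl, Nat.zero_le _⟩, Nat.mul_div_cancel_left t (Nat.succ_pos e)]
    simp only [mul_right_inj' (Nat.succ_ne_zero e)]
    rcases (show (t = p - c ∨ t = p - c + 2) ∨ t = p - c + 1 ∨ (¬ (t = p - c ∨ t = p - c + 2) ∧ t ≠ p - c + 1) by omega) with ht | ht | ht
    · have hT : min t (k - t - c) = p - c := by rw [Nat.min_def]; split_ifs <;> omega
      rw [if_neg (by omega), hT, if_neg (by omega), Nat.sub_add_cancel hcp.le, Nat.sub_self, Nat.choose_zero_right, if_pos ht, if_neg (by omega)]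
    · have hT : min t (k - t - c) = p - c + 1 := by rw [Nat.min_def]; split_ifs <;> omega
      rw [if_neg (by omega), hT, if_neg (by omega), show p - c + 1 + c - p = 1 by omega, Nat.choose_one_right, if_neg (by omega), if_pos ht,
        Nat.zero_add]
    · rw [if_neg ht.1, if_neg ht.2, Nat.add_zero]
      split_ifs with hlt hb
      · rfl
      · rfl
      · exfalso
        revert hb
        rw [imp_false, not_not, Nat.min_def]
        split_ifs <;> omega
  · rw [if_neg (fun h => hd h.1), if_neg, if_neg (fun h => hd (by rw [h]; exact Dvd.intro _ rfl))]
    rintro (h | h)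
    · exact hd (by rw [h]; exact Dvd.intro _ rfl)
    · exact hd (by rw [h]; exact Dvd.intro _ rfl)

/-! ## §3 THE THIRD BOUNDARY `k + c = 2p + 2`: drops `1, k, k + C(k,2), …, k + C(k,2)·e, …, k + C(k,2), k, 1` across two bands -/

/-- (Σ1) the one-coordinate labels contribute `k · [j + 1 ≤ (e+1)(p − c + 1) ≤ j + e] + k · [j + 1 ≤ (e+1)(p − c + 2) ≤ j + e]` in total
(`c < p`, `k + c = 2p + 2`; (T1) and (C1') twice). -/
theorem sum_filter_card_eq_one_single (p k e c j : ℕ) (hcp : c < p) (hk : k + c = 2 * p + 2) :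
    (∑ μ ∈ Finset.univ.filter (fun μ : Fin k → Fin (e + 1) => (Finset.univ.filter (fun l => (μ l : ℕ) ≠ 0)).card = 1),
      (if (e + 1) ∣ (j + ∑ i, (μ i : ℕ)) ∧ (e + 1) * (Finset.univ.filter (fun l => (μ l : ℕ) ≠ 0)).card ≤ j + ∑ i, (μ i : ℕ) then
        (if k - (Finset.univ.filter (fun l => (μ l : ℕ) ≠ 0)).card < ((j + ∑ i, (μ i : ℕ)) / (e + 1) - (Finset.univ.filter (fun l => (μ l : ℕ) ≠ 0)).card) + c then 0
         else if min ((j + ∑ i, (μ i : ℕ)) / (e + 1) - (Finset.univ.filter (fun l => (μ l : ℕ) ≠ 0)).card)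
             (k - (Finset.univ.filter (fun l => (μ l : ℕ) ≠ 0)).card -
               ((j + ∑ i, (μ i : ℕ)) / (e + 1) - (Finset.univ.filter (fun l => (μ l : ℕ) ≠ 0)).card) - c) + c < p then 0
         else (k - (Finset.univ.filter (fun l => (μ l : ℕ) ≠ 0)).card).choose (min ((j + ∑ i, (μ i : ℕ)) / (e + 1) - (Finset.univ.filter (fun l => (μ l : ℕ) ≠ 0)).card)
             (k - (Finset.univ.filter (fun l => (μ l : ℕ) ≠ 0)).card -
               ((j + ∑ i, (μ i : ℕ)) / (e + 1) - (Finset.univ.filter (fun l => (μ l : ℕ) ≠ 0)).card) - c) + c - p))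
       else 0)) =
    (if j + 1 ≤ (e + 1) * (p - c + 1) ∧ (e + 1) * (p - c + 1) ≤ j + e then k else 0) +
      (if j + 1 ≤ (e + 1) * (p - c + 2) ∧ (e + 1) * (p - c + 2) ≤ j + e then k else 0) := by
  have hsplit : ∀ μ : Fin k → Fin (e + 1), (if j + ∑ i, (μ i : ℕ) = (e + 1) * (p - c + 1) ∨ j + ∑ i, (μ i : ℕ) = (e + 1) * (p - c + 2) then 1 else 0 : ℕ) =
      (if j + ∑ i, (μ i : ℕ) = (e + 1) * (p - c + 1) then 1 else 0) + (if j + ∑ i, (μ i : ℕ) = (e + 1) * (p - c + 2) then 1 else 0) := by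
    intro μ
    by_cases hA : j + ∑ i, (μ i : ℕ) = (e + 1) * (p - c + 1)
    · rw [if_pos (Or.inl hA), if_pos hA, if_neg (by rw [hA]; exact fun h => absurd (Nat.eq_of_mul_eq_mul_left (Nat.succ_pos e) h) (by omega))]
    · by_cases hB : j + ∑ i, (μ i : ℕ) = (e + 1) * (p - c + 2)
      · rw [if_pos (Or.inr hB), if_neg hA, if_pos hB]
      · rw [if_neg (not_or.mpr ⟨hA, hB⟩), if_neg hA, if_neg hB]
  rw [Finset.sum_congr rfl (fun μ hμ => single_eq_ite_of_card_eq_one p k e c j hcp hk μ (Finset.mem_filter.mp hμ).2)]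
  simp only [hsplit]
  rw [Finset.sum_add_distrib, ← Finset.sum_filter, Finset.filter_filter, Finset.sum_const, smul_eq_mul, mul_one,
    card_filter_card_eq_one_and_add_sum_eq, ← Finset.sum_filter, Finset.filter_filter, Finset.sum_const, smul_eq_mul, mul_one,
    card_filter_card_eq_one_and_add_sum_eq]

/-- (Σ2) the two-coordinate labels contribute `C(k,2) · (e − |j − (e+1)(p − c + 1)|)` in total (`c < p`, `k + c = 2p + 2`; (T2) and (C2) with
`a = (e+1)(p − c + 2) − j`; the expression vanishes by truncation outside `(e+1)(p − c) < j < (e+1)(p − c + 2)`). -/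
theorem sum_filter_card_eq_two_single (p k e c j : ℕ) (hcp : c < p) (hk : k + c = 2 * p + 2) :
    (∑ μ ∈ Finset.univ.filter (fun μ : Fin k → Fin (e + 1) => (Finset.univ.filter (fun l => (μ l : ℕ) ≠ 0)).card = 2),
      (if (e + 1) ∣ (j + ∑ i, (μ i : ℕ)) ∧ (e + 1) * (Finset.univ.filter (fun l => (μ l : ℕ) ≠ 0)).card ≤ j + ∑ i, (μ i : ℕ) then
        (if k - (Finset.univ.filter (fun l => (μ l : ℕ) ≠ 0)).card < ((j + ∑ i, (μ i : ℕ)) / (e + 1) - (Finset.univ.filter (fun l => (μ l : ℕ) ≠ 0)).card) + c then 0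
         else if min ((j + ∑ i, (μ i : ℕ)) / (e + 1) - (Finset.univ.filter (fun l => (μ l : ℕ) ≠ 0)).card)
             (k - (Finset.univ.filter (fun l => (μ l : ℕ) ≠ 0)).card -
               ((j + ∑ i, (μ i : ℕ)) / (e + 1) - (Finset.univ.filter (fun l => (μ l : ℕ) ≠ 0)).card) - c) + c < p then 0
         else (k - (Finset.univ.filter (fun l => (μ l : ℕ) ≠ 0)).card).choose (min ((j + ∑ i, (μ i : ℕ)) / (e + 1) - (Finset.univ.filter (fun l => (μ l : ℕ) ≠ 0)).card)
             (k - (Finset.univ.filter (fun l => (μ l : ℕ) ≠ 0)).card -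
               ((j + ∑ i, (μ i : ℕ)) / (e + 1) - (Finset.univ.filter (fun l => (μ l : ℕ) ≠ 0)).card) - c) + c - p))
       else 0)) =
    k.choose 2 * (e - (((e + 1) * (p - c + 1) - j) + (j - (e + 1) * (p - c + 1)))) := by
  have hU : (e + 1) * (p - c + 2) = (e + 1) * (p - c + 1) + (e + 1) := by rw [Nat.mul_succ]
  rw [Finset.sum_congr rfl (fun μ hμ => single_eq_ite_of_card_eq_two p k e c j hcp hk μ (Finset.mem_filter.mp hμ).2),
    ← Finset.sum_filter, Finset.filter_filter, Finset.sum_const, smul_eq_mul, mul_one]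
  by_cases hj : j ≤ (e + 1) * (p - c + 2)
  · have h := card_filter_card_eq_two_and_sum_eq k e ((e + 1) * (p - c + 2) - j)
    rw [Finset.filter_congr (fun μ _ => show (Finset.univ.filter (fun l => (μ l : ℕ) ≠ 0)).card = 2 ∧
        (∑ i, (μ i : ℕ)) = (e + 1) * (p - c + 2) - j ↔ (Finset.univ.filter (fun l => (μ l : ℕ) ≠ 0)).card = 2 ∧
        j + ∑ i, (μ i : ℕ) = (e + 1) * (p - c + 2) by omega)] at h
    rw [h]
    congr 1
    omega
  · rw [Finset.card_eq_zero.mpr (Finset.filter_eq_empty_iff.mpr (fun μ _ h => absurd h.2 (by omega))),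
      show (e - (((e + 1) * (p - c + 1) - j) + (j - (e + 1) * (p - c + 1)))) = 0 by omega, mul_zero]

/-- (Σ) the whole correction sum for `c < p`, `k + c = 2p + 2`:
`Σ_μ = [j = (e+1)(p − c) ∨ j = (e+1)(p − c + 2)] + k · [(e+1)(p − c) < j < (e+1)(p − c + 2)] + C(k,2) · (e − |j − (e+1)(p − c + 1)|)`
((T0) + (Σ1) + (Σ2); labels with `s ≥ 3` vanish by (T3)). -/
theorem sum_single_eq (p k e c j : ℕ) (hcp : c < p) (hk : k + c = 2 * p + 2) :
    (∑ μ : Fin k → Fin (e + 1),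
      (if (e + 1) ∣ (j + ∑ i, (μ i : ℕ)) ∧ (e + 1) * (Finset.univ.filter (fun l => (μ l : ℕ) ≠ 0)).card ≤ j + ∑ i, (μ i : ℕ) then
        (if k - (Finset.univ.filter (fun l => (μ l : ℕ) ≠ 0)).card < ((j + ∑ i, (μ i : ℕ)) / (e + 1) - (Finset.univ.filter (fun l => (μ l : ℕ) ≠ 0)).card) + c then 0
         else if min ((j + ∑ i, (μ i : ℕ)) / (e + 1) - (Finset.univ.filter (fun l => (μ l : ℕ) ≠ 0)).card)
             (k - (Finset.univ.filter (fun l => (μ l : ℕ) ≠ 0)).card -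
               ((j + ∑ i, (μ i : ℕ)) / (e + 1) - (Finset.univ.filter (fun l => (μ l : ℕ) ≠ 0)).card) - c) + c < p then 0
         else (k - (Finset.univ.filter (fun l => (μ l : ℕ) ≠ 0)).card).choose (min ((j + ∑ i, (μ i : ℕ)) / (e + 1) - (Finset.univ.filter (fun l => (μ l : ℕ) ≠ 0)).card)
             (k - (Finset.univ.filter (fun l => (μ l : ℕ) ≠ 0)).card -
               ((j + ∑ i, (μ i : ℕ)) / (e + 1) - (Finset.univ.filter (fun l => (μ l : ℕ) ≠ 0)).card) - c) + c - p))
       else 0)) =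
    ((if j = (e + 1) * (p - c) ∨ j = (e + 1) * (p - c + 2) then 1 else 0) +
        (if (e + 1) * (p - c) < j ∧ j < (e + 1) * (p - c + 2) then k else 0) + k.choose 2 * (e - (((e + 1) * (p - c + 1) - j) + (j - (e + 1) * (p - c + 1))))) := by
  have hU : (e + 1) * (p - c + 2) = (e + 1) * (p - c + 1) + (e + 1) := by rw [Nat.mul_succ]
  have hC : (e + 1) * (p - c + 1) = (e + 1) * (p - c) + (e + 1) := by rw [Nat.mul_succ]
  rw [← Finset.sum_filter_add_sum_filter_not Finset.univ
      (fun μ : Fin k → Fin (e + 1) => (Finset.univ.filter (fun l => (μ l : ℕ) ≠ 0)).card = 1),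
    sum_filter_card_eq_one_single p k e c j hcp hk,
    ← Finset.sum_filter_add_sum_filter_not (Finset.univ.filter (fun μ : Fin k → Fin (e + 1) => ¬ (Finset.univ.filter (fun l => (μ l : ℕ) ≠ 0)).card = 1))
      (fun μ : Fin k → Fin (e + 1) => (Finset.univ.filter (fun l => (μ l : ℕ) ≠ 0)).card = 2),
    Finset.filter_filter, Finset.filter_filter,
    Finset.filter_congr (fun (μ : Fin k → Fin (e + 1)) _ =>
      show ¬ (Finset.univ.filter (fun l => (μ l : ℕ) ≠ 0)).card = 1 ∧ (Finset.univ.filter (fun l => (μ l : ℕ) ≠ 0)).card = 2 ↔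
        (Finset.univ.filter (fun l => (μ l : ℕ) ≠ 0)).card = 2 by omega),
    sum_filter_card_eq_two_single p k e c j hcp hk,
    Finset.sum_eq_single_of_mem (fun _ => (0 : Fin (e + 1)))
      (Finset.mem_filter.mpr ⟨Finset.mem_univ _, by simp⟩) (fun μ hμ hne => ?_)]
  · have h0 := single_zero_label p k e c j hcp hk
    simp only [] at h0
    rw [h0]
    split_ifs <;> omega
  · obtain ⟨l, hl⟩ := Function.ne_iff.mp hne
    have hs1 : 1 ≤ (Finset.univ.filter (fun l => (μ l : ℕ) ≠ 0)).card :=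
      Finset.card_pos.mpr ⟨l, Finset.mem_filter.mpr ⟨Finset.mem_univ _, fun h => hl (Fin.ext h)⟩⟩
    exact single_eq_zero_of_three_le p k e c j hk.le μ (by have := (Finset.mem_filter.mp hμ).2; omega)

/-- **(BDRY3) THE THIRD BOUNDARY `k + c = 2p + 2` DROPS `1, k, k + C(k,2), …, k + C(k,2)·e, …, k + C(k,2), k, 1` ACROSS TWO BANDS.** For a prime
`p`, `2 ≤ c < p` and `k = 2p + 2 − c` variables (inside anchor 307's first band `k < 2p + c`), anchor 229's multiplicity matrix of `×q^c` on
`K[x₁,…,x_k]/(xᵢ^{e+2})` at level `j` (VERBATIM) has characteristic-`p` rank `rank_{K₀} − 1` at the two levels `j = (e+1)(p − c)`,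
`j = (e+1)(p − c + 2)`, `rank_{K₀} − k − C(k,2)·(e − |j − (e+1)(p − c + 1)|)` at the `2e + 1` levels strictly between them (so `rank_{K₀} − k − C(k,2)·e`
at the centre `j = (e+1)(p − c + 1)`), and `rank_{K₀}` at every other level ((BAND) and (Σ)). Anchors 304 (BDRY) / 307 (BDRY2) are the first two
boundaries `k + c = 2p`, `2p + 1`. -/
theorem rank_charP_add_eq_rank_charZero_third_boundary (K K₀ : Type*) [Field K] [Field K₀] (p : ℕ) [CharP K p] [CharZero K₀] (hp : p.Prime)
    (k e c j : ℕ) (hc : 1 < c) (hcp : c < p) (hk : k + c = 2 * p + 2) :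
    (Matrix.of fun (v : {v : Fin k → Fin (e + 2) // (∑ i, (v i : ℕ)) + j = k * (e + 1)})
        (m : {m : Fin k → Fin (e + 2) // (∑ i, (m i : ℕ)) + (j + c * (e + 1)) = k * (e + 1)}) =>
      ((((List.flatMap (colR (e + 3)))^[c] [List.ofFn (fun i => (m.1 i : ℕ))]).count (List.ofFn (fun i => (v.1 i : ℕ))) : ℕ) : K)).rank +
      ((if j = (e + 1) * (p - c) ∨ j = (e + 1) * (p - c + 2) then 1 else 0) +
        (if (e + 1) * (p - c) < j ∧ j < (e + 1) * (p - c + 2) then k else 0) + k.choose 2 * (e - (((e + 1) * (p - c + 1) - j) + (j - (e + 1) * (p - c + 1))))) =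
    (Matrix.of fun (v : {v : Fin k → Fin (e + 2) // (∑ i, (v i : ℕ)) + j = k * (e + 1)})
        (m : {m : Fin k → Fin (e + 2) // (∑ i, (m i : ℕ)) + (j + c * (e + 1)) = k * (e + 1)}) =>
      ((((List.flatMap (colR (e + 3)))^[c] [List.ofFn (fun i => (m.1 i : ℕ))]).count (List.ofFn (fun i => (v.1 i : ℕ))) : ℕ) : K₀)).rank := by
  rw [← sum_single_eq p k e c j hcp hk]
  exact rank_charP_add_sum_single_eq_rank_charZero K K₀ p hp k e c j hcp (by omega)

end Summit.HodgeConjecture.HodgeConjecture.HodgeLocus.Census.UnitColumnRankDropThirdBoundary
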